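import Summits.QuantumFields.YangMills.Theorems.WeakCouplingRates
import HarnessLib

/-!
# `JensenFloor` (stmt-QuantumFields-22518), line `birth`: translation invariance + centring (registered stub `stub_centredSum`)

Support file for the crux item stmt-QuantumFields-22518 (`Summit.QuantumFields.YangMills.Theses.SourcedPressureJensen.JensenFloor`,
route `SourcedPressureJensen`, a RECORD-label rung line: its target `WeakCouplingRates.XiPow` is an UPPER bound on the lattice gap,
NOT the Clay mass gap).  Registered stub `stub_centredSum` of the line `birth`: for the torus Wilson state `μ = μ_{Λ_{L+1}, β}` and
the centred two-plaquette source `H = Σ_{x ∈ Λ} (β c(x) − β⟨c⟩)(β c(x + n e₀) − β⟨c⟩)` (`c` the `(1,2)`-plaquette cost at the origin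
read through the periodic lift, `⟨c⟩ = E_μ[c]`), the mean per site is `β²` times the connected plaquette–plaquette correlator:
`|Λ|⁻¹ E_μ[H] = β² (E_μ[c₀ c_{n e₀}] − E_μ[c₀] E_μ[c_{n e₀}])`, `|Λ| = (L+1)⁴`.

**Proof.** Each summand is the translate by `x` of the `x = 0` summand `g = (β c₀ − β⟨c⟩)(β c_{n e₀} − β⟨c⟩)`; the periodic lift
intertwines lattice and torus translations (`toTorusObservable_comp_configShift`) and the torus Wilson state is translation invariant
(`wilsonExpectation_comp_torusConfigShift`), so `E[H] = |Λ| · E[g]` (the summands are bounded continuous, hence integrable, so the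
finite sum commutes with the integral).  Expanding the product and using linearity of the integral on the probability space,
`E[(βa − βE a)(βb − βE a)] = β² (E[ab] − E[a] E[b])`. [folklore]
-/

namespace Summit.QuantumFields.YangMills.Cruxes.JensenFloor.Birth

open MeasureTheory
open Literature.MathematicalPhysics.QuantumFieldTheory Literature.MathematicalPhysics.QuantumLattice
  Summit.QuantumFields.YangMills.Theorems.WeakCouplingRates

/-- **Centred product, integrated.** On a probability space, for integrable `a`, `b` with `ab` integrable and every real `β`,
`∫ (β a − β ∫a)(β b − β ∫a) = β² (∫ ab − (∫ a)(∫ b))`. [folklore] -/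
theorem integral_centred_mul_centred {Ω : Type*} [MeasurableSpace Ω] {μ : Measure Ω} [IsProbabilityMeasure μ]
    {a b : Ω → ℝ} (ha : Integrable a μ) (hb : Integrable b μ) (hab : Integrable (fun ω => a ω * b ω) μ) (β : ℝ) :
    ∫ ω, (β * a ω - β * ∫ ω', a ω' ∂μ) * (β * b ω - β * ∫ ω', a ω' ∂μ) ∂μ =
      β ^ 2 * (∫ ω, a ω * b ω ∂μ - (∫ ω, a ω ∂μ) * ∫ ω, b ω ∂μ) := by
  set m := ∫ ω', a ω' ∂μ with hm
  have h1 : (fun ω => (β * a ω - β * m) * (β * b ω - β * m)) =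
      fun ω => β ^ 2 * (a ω * b ω) - β ^ 2 * m * b ω - β ^ 2 * m * a ω + β ^ 2 * m ^ 2 := by
    funext ω; ring
  have i1 : Integrable (fun ω => β ^ 2 * (a ω * b ω)) μ := hab.const_mul _
  have i2 : Integrable (fun ω => β ^ 2 * m * b ω) μ := hb.const_mul _
  have i3 : Integrable (fun ω => β ^ 2 * m * a ω) μ := ha.const_mul _
  have i12 : Integrable (fun ω => β ^ 2 * (a ω * b ω) - β ^ 2 * m * b ω) μ := i1.sub i2
  have i123 : Integrable (fun ω => β ^ 2 * (a ω * b ω) - β ^ 2 * m * b ω - β ^ 2 * m * a ω) μ := i12.sub i3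
  have i4 : Integrable (fun _ : Ω => β ^ 2 * m ^ 2) μ := integrable_const _
  have hconst : ∫ _ω, β ^ 2 * m ^ 2 ∂μ = β ^ 2 * m ^ 2 := by simp
  rw [h1, integral_add i123 i4, integral_sub i12 i3, integral_sub i1 i2, integral_const_mul, integral_const_mul,
    integral_const_mul, hconst, ← hm]
  ring

/-- A continuous real function on a compact (opens-measurable) space is integrable for every finite measure. [folklore] -/
theorem integrable_of_continuous_of_compactSpace {X : Type*} [TopologicalSpace X] [CompactSpace X] [MeasurableSpace X]
    [OpensMeasurableSpace X] {μ : Measure X} [IsFiniteMeasure μ] {F : X → ℝ} (hF : Continuous F) : Integrable F μ := by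
  obtain ⟨C, hC⟩ := (isCompact_univ (X := X)).exists_bound_of_continuousOn hF.continuousOn
  exact Integrable.of_bound hF.aestronglyMeasurable C (ae_of_all _ fun x => hC x (Set.mem_univ x))

/-- Finite sums commute with torus Wilson expectations (integrable summands). [folklore] -/
theorem wilsonExpectation_finset_sum {d L N : ℕ} [NeZero L] {G : Type*} [Group G] [TopologicalSpace G]
    [IsTopologicalGroup G] [CompactSpace G] [MeasurableSpace G] [BorelSpace G] (ρ : G →* Matrix (Fin N) (Fin N) ℂ)
    (β : ℝ) {ι : Type*} (s : Finset ι) (F : ι → GaugeConfig d L G → ℝ)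
    (hF : ∀ i ∈ s, Integrable (F i) (wilsonMeasure ρ β)) :
    wilsonExpectation ρ β (fun U => ∑ i ∈ s, F i U) = ∑ i ∈ s, wilsonExpectation ρ β (F i) :=
  integral_finsetSum s hF

/-- `stub_centredSum` — **translation invariance + centring** (registered stub of the line `birth` for the crux `JensenFloor`):
the torus mean per site of the centred two-plaquette source is `β²` times the connected plaquette–plaquette correlator,
`|Λ_{L+1}|⁻¹ E[Σ_x (β c(x) − β⟨c⟩)(β c(x + n e₀) − β⟨c⟩)] = β² (E[c₀ c_{n e₀}] − E[c₀] E[c_{n e₀}])` — torus translation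
invariance of the Wilson state (`toTorusObservable_comp_configShift`, `wilsonExpectation_comp_torusConfigShift`), interchange of the
finite sum with the integral (bounded continuous summands), and bilinear expansion of the centred product. [folklore] -/
theorem stub_centredSum :
    ∀ (G : Type) [Group G] [TopologicalSpace G] [IsTopologicalGroup G] [CompactSpace G]
      [MeasurableSpace G] [BorelSpace G] (r : LatticeRep G) (β : ℝ) (n : ℕ) (L : ℕ),
      ((L + 1 : ℝ) ^ 4)⁻¹ *
          wilsonExpectation r.ρ β (fun U : GaugeConfig 4 (L + 1) G =>
            ∑ x : Fin 4 → Fin (L + 1),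
              toTorusObservable (L + 1)
                (fun V : LGConfig 4 G =>
                  (β * plaqCost0 r.ρ 1 2 (configShift (fun i => -((x i : ℕ) : ℤ)) V) -
                      β * wilsonExpectation r.ρ β (toTorusObservable (L + 1) (plaqCost0 r.ρ 1 2 : LGConfig 4 G → ℝ))) *
                    (β * plaqCost0 r.ρ 1 2 (timeShiftLG n (configShift (fun i => -((x i : ℕ) : ℤ)) V)) -
                      β * wilsonExpectation r.ρ β (toTorusObservable (L + 1) (plaqCost0 r.ρ 1 2 : LGConfig 4 G → ℝ))))
                U) =
        β ^ 2 *
          (wilsonExpectation r.ρ β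
              (toTorusObservable (L + 1) fun U : LGConfig 4 G =>
                plaqCost0 r.ρ 1 2 U * plaqCost0 r.ρ 1 2 (timeShiftLG n U)) -
            wilsonExpectation r.ρ β (toTorusObservable (L + 1) (plaqCost0 r.ρ 1 2 : LGConfig 4 G → ℝ)) *
              wilsonExpectation r.ρ β
                (toTorusObservable (L + 1) fun U : LGConfig 4 G => plaqCost0 r.ρ 1 2 (timeShiftLG n U))) := by
  intro G _ _ _ _ _ _ r β n L
  haveI : SecondCountableTopology G :=
    (r.continuous.isClosedEmbedding r.injective).isEmbedding.secondCountableTopology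
  haveI := isProbabilityMeasure_wilsonMeasure (d := 4) (L := L + 1) r.ρ r.continuous β
  have hc : Continuous (plaqCost0 (d := 4) (G := G) r.ρ 1 2) := (continuous_bounded_plaqCost0 r.ρ r.continuous 1 2).1
  have ht : Continuous (timeShiftLG (d := 4) (G := G) n : LGConfig 4 G → LGConfig 4 G) := continuous_timeShiftLG n
  have hl : Continuous (torusLift (d := 4) (G := G) (L + 1)) := continuous_torusLift (L + 1)
  set c : LGConfig 4 G → ℝ := plaqCost0 r.ρ 1 2 with hc_def
  set m : ℝ := wilsonExpectation r.ρ β (toTorusObservable (L + 1) c) with hm_def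
  -- the unshifted summand `g = (β c₀ − β m)(β c_{n e₀} − β m)`
  set g : LGConfig 4 G → ℝ := fun W => (β * c W - β * m) * (β * c (timeShiftLG n W) - β * m) with hg_def
  -- (1) every shifted summand has the expectation of `g` (torus translation invariance)
  have hshift : ∀ x : Fin 4 → Fin (L + 1),
      wilsonExpectation r.ρ β (toTorusObservable (L + 1) fun V : LGConfig 4 G =>
        (β * c (configShift (fun i => -((x i : ℕ) : ℤ)) V) - β * m) *
          (β * c (timeShiftLG n (configShift (fun i => -((x i : ℕ) : ℤ)) V)) - β * m)) =
      wilsonExpectation r.ρ β (toTorusObservable (L + 1) g) := fun x =>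
    (congrArg (wilsonExpectation r.ρ β)
        (toTorusObservable_comp_configShift (G := G) (L + 1) (fun i => -((x i : ℕ) : ℤ)) g)).trans
      (wilsonExpectation_comp_torusConfigShift r.ρ β _ _)
  -- (2) the summands are integrable (bounded continuous on the compact configuration space)
  have hint : ∀ x ∈ (Finset.univ : Finset (Fin 4 → Fin (L + 1))),
      Integrable (toTorusObservable (L + 1) fun V : LGConfig 4 G =>
        (β * c (configShift (fun i => -((x i : ℕ) : ℤ)) V) - β * m) *
          (β * c (timeShiftLG n (configShift (fun i => -((x i : ℕ) : ℤ)) V)) - β * m)) (wilsonMeasure r.ρ β) := by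
    intro x _
    have hs : Continuous (configShift (G := G) (fun i => -((x i : ℕ) : ℤ)) : LGConfig 4 G → LGConfig 4 G) :=
      continuous_configShift _
    exact integrable_of_continuous_of_compactSpace
      ((((continuous_const.mul (hc.comp hs)).sub continuous_const).mul
        ((continuous_const.mul (hc.comp (ht.comp hs))).sub continuous_const)).comp hl)
  -- (3) the expectation of `g` is `β²` times the connected correlator
  have hg_exp : wilsonExpectation r.ρ β (toTorusObservable (L + 1) g) =
      β ^ 2 * (wilsonExpectation r.ρ β (toTorusObservable (L + 1) fun U : LGConfig 4 G => c U * c (timeShiftLG n U)) -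
        m * wilsonExpectation r.ρ β (toTorusObservable (L + 1) fun U : LGConfig 4 G => c (timeShiftLG n U))) := by
    have ia : Integrable (fun U : GaugeConfig 4 (L + 1) G => c (torusLift (L + 1) U)) (wilsonMeasure r.ρ β) :=
      integrable_of_continuous_of_compactSpace (hc.comp hl)
    have ib : Integrable (fun U : GaugeConfig 4 (L + 1) G => c (timeShiftLG n (torusLift (L + 1) U))) (wilsonMeasure r.ρ β) :=
      integrable_of_continuous_of_compactSpace (hc.comp (ht.comp hl))
    have iab : Integrable (fun U : GaugeConfig 4 (L + 1) G =>
        c (torusLift (L + 1) U) * c (timeShiftLG n (torusLift (L + 1) U))) (wilsonMeasure r.ρ β) :=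
      integrable_of_continuous_of_compactSpace ((hc.comp hl).mul (hc.comp (ht.comp hl)))
    rw [hm_def]
    simp only [wilsonExpectation, toTorusObservable_apply, hg_def]
    exact integral_centred_mul_centred ia ib iab β
  -- (4) assemble: `E[Σ_x g_x] = |Λ| E[g]`
  rw [wilsonExpectation_finset_sum r.ρ β Finset.univ _ hint, Finset.sum_congr rfl fun x _ => hshift x, Finset.sum_const,
    Finset.card_univ, Fintype.card_fun, Fintype.card_fin, Fintype.card_fin, nsmul_eq_mul, hg_exp]
  have hL : ((L : ℝ) + 1) ^ 4 ≠ 0 := by positivity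
  push_cast
  rw [inv_mul_cancel_left₀ hL]

end Summit.QuantumFields.YangMills.Cruxes.JensenFloor.Birth
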